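import Summits.ResolutionOfSingularities.ResolutionOfSingularities.Theorems.WeightedInvariantIota3DropDivisor
import HarnessLib

/-!
# (DROP)₃ REDUCED TO (D-b): the `ι₃ᵗ`-drop at the `t`-homogeneous successors OVER THE CLOSED POINT is all that remains of hgame
# (door `HypersurfaceCentreConstruction`, stmt-ResolutionOfSingularities-19897; gap list of `stub_keyRungGrHomLE_three`)

Helper for `stub_keyRungGrHomLE_three` (def-free, `--supports 19897`).  Sequel of …Iota3PresThree ((PRES)₃), …Iota3DropTypeA (TYPE (a)),
…Iota3DropDivCore / …Iota3DropDivisor ((D-div)).  At a door position (`S` regular local e.f.t. over a perfect field, `dim S ≤ 3`,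
`0 ≠ f ∈ 𝔪²`) with canonical centre `P` and a weighted rsp presentation `(u, w)` of `(P, J₃ᵗ)`, a successor prime `𝔫` of the cobordant
blow-up lies over a prime `Q = 𝔫 ∩ S ⊇ P`; by heights (`Ideal.height_add_one_le_of_lt_of_isPrime`,
`IsLocalization.AtPrime.ringKrullDim_eq_height`): `Q = 𝔪` — (D-b), the hypothesis; `Q = P ≠ 𝔪` — `dim S_P ≤ 2`, TYPE (a)
(`Iota3.iotaFlatT_successor_lt_of_over_generic_point`); `P < Q < 𝔪` — `dim S_P ≤ 1`, the divisor centre, no singular successor at all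
(`DivCentre.weightedDrop_of_dim_le_one`).
* **`Iota3.weightedDropHom_of_drop_over_closedPoint_door`** — (DROP)₃ at one position ⟸ (D-b) at that position.
* **`Iota3.canonicalGameClauseHomLE_three_of_dropb`** — hgame ⟸ (D-b).
* **`keyRungGrHomLE_three_of_tieDescent_dropb`**, **`keyRungGrHomLE_three_of_c11_dropb`**, **`pRungGrHomLE_three_of_tieDescent_dropb`** —
  THE GAP LISTS OF RECORD after this hand: `KeyRungGrHomLE 3 p` / `PRungGrHomLE 3 p iotaFlatT jFlatT` from the typing item (hD = (desc-τ) as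
  typed, or (c11)≤3 as typed) and **(D-b)** = «at every door position with canonical centre `P` and every weighted rsp presentation `(u, w)` of
  `(P, J₃ᵗ)`, `ι₃ᵗ (B_𝔫) (g/1) < ι₃ᵗ S f` at every `t`-HOMOGENEOUS successor prime `𝔫` of `cobordantAlgebra' u w` OVER THE CLOSED POINT
  (`𝔪_S·B ≤ 𝔫`, `t⁻¹ ∈ 𝔫`, off the vertex, `f = (t⁻¹)ᵃ g`, `t⁻¹ ∤ g`, `g/1 ∈ 𝔪_𝔫²`)» [XL — the characteristic-`p` point drop, the crux].
[OURS · L1 W4.3 · audit glue; AI work, weaker than expert review; nothing here is a statement of the manuscript under review.]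

## References

* H. Matsumura, *Commutative Ring Theory* (1987), §5 (height, `ht P + 1 ≤ ht Q` for `P < Q`). [Matsumura1987]
* J. Włodarczyk, *Functorial resolution by torus actions*, arXiv:2203.03090, Def. 2.3.5. [Wlodarczyk2022]
-/

noncomputable section

set_option linter.dupNamespace false -- mandated namespace of this single-conjunct summit

open IsLocalRing Literature.AlgebraicGeometry.Resolution
open Summit.ResolutionOfSingularities.ResolutionOfSingularities.Theorems
open Summit.ResolutionOfSingularities.ResolutionOfSingularities.Theorems.ContactCylinder

namespace Summit.ResolutionOfSingularities.ResolutionOfSingularities.Cruxes.HypersurfaceCentreConstruction.LocalEngine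

namespace Iota3

/-! ## §1 Heights -/

/-- `P < Q` primes and `ht Q ≤ k + 1` give `ht P ≤ k` (`ht P + 1 ≤ ht Q`). [cite: Matsumura1987, §5] -/
theorem height_le_of_lt_of_height_le {S : Type} [CommRing S] {I J : Ideal S} [I.IsPrime] [J.IsPrime] (h : I < J) {k : ℕ}
    (hJ : J.height ≤ (k : ℕ∞) + 1) : I.height ≤ (k : ℕ∞) := by
  have h1 := (Ideal.height_add_one_le_of_lt_of_isPrime h).trans hJ
  have hne : I.height ≠ ⊤ := by
    intro ht
    rw [ht, top_add] at h1
    have : ((k : ℕ∞) + 1) ≠ ⊤ := by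
      have : ((k : ℕ∞) + 1) = ((k + 1 : ℕ) : ℕ∞) := by push_cast; rfl
      rw [this]; exact ENat.coe_ne_top _
    exact this (top_le_iff.mp h1)
  obtain ⟨m, hm⟩ := ENat.ne_top_iff_exists.mp hne
  rw [← hm] at h1 ⊢
  have : m + 1 ≤ k + 1 := by exact_mod_cast h1
  exact_mod_cast (by omega : m ≤ k)

/-- The Krull dimension of `S_I` is at most `k` once `ht I ≤ k`. [folklore] -/
theorem ringKrullDim_localization_le_of_height_le {S : Type} [CommRing S] (I : Ideal S) [I.IsPrime] {k : ℕ}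
    (h : I.height ≤ (k : ℕ∞)) : ringKrullDim (Localization.AtPrime I) ≤ k := by
  rw [IsLocalization.AtPrime.ringKrullDim_eq_height I (Localization.AtPrime I)]
  exact_mod_cast h

/-- In a local ring of Krull dimension `≤ 3`, `ht 𝔪 ≤ 2 + 1`. [folklore] -/
theorem height_maximalIdeal_le_of_ringKrullDim_le_three {S : Type} [CommRing S] [IsLocalRing S] (hd : ringKrullDim S ≤ 3) :
    (maximalIdeal S).height ≤ ((2 : ℕ) : ℕ∞) + 1 := by
  rw [← IsLocalRing.maximalIdeal_height_eq_ringKrullDim] at hd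
  have h3 : (maximalIdeal S).height ≤ 3 := by
    rw [← WithBot.coe_le_coe, WithBot.coe_ofNat]
    exact hd
  have : ((2 : ℕ) : ℕ∞) + 1 = 3 := by norm_num
  rw [this]
  exact h3

/-! ## §2 (DROP)₃ at one position from (D-b) at that position -/

/-- **(DROP)₃ AT A DOOR POSITION ⟸ THE DROP AT THE `t`-HOMOGENEOUS SUCCESSORS OVER THE CLOSED POINT.**  `k₀` perfect of characteristic `p`;
`S` regular local e.f.t. over `k₀`, `dim S ≤ 3`; `0 ≠ f ∈ 𝔪²`; `P` prime, `f ∈ P`, `topStratum ι₀ S f = V(P)`; `(u, w)` a regular system of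
parameters with weights, `span {u_i : w_i > 0} = P`, `weightedMonomialIdeal u w m = jFlatT S f m`.  If `ι₃ᵗ` drops at every
`t`-homogeneous successor prime `𝔫` with `𝔪_S · B ≤ 𝔫` (off the vertex, `t⁻¹ ∈ 𝔫`, `g/1 ∈ 𝔪_𝔫²`), then `WeightedDropHom iotaFlatT S f P u w`.
(Successors over `Q = P ≠ 𝔪`: TYPE (a); over `P < Q < 𝔪`: divisor centre, vacuous.) [OURS · L1 W4.3 · (DROP)₃ ⟸ (D-b)] -/
theorem weightedDropHom_of_drop_over_closedPoint_door (p : ℕ) (k₀ : Type) [Field k₀] [CharP k₀ p] [PerfectField k₀]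
    (S : Type) [CommRing S] [IsRegularLocalRing S] [Algebra k₀ S] [Algebra.EssFiniteType k₀ S]
    {f : S} (hd : ringKrullDim S ≤ 3) (hf0 : f ≠ 0) (hf2 : f ∈ (maximalIdeal S) ^ 2)
    (P : Ideal S) [P.IsPrime] (hfP : f ∈ P) (hE : topStratum iotaOrdEpsTau S f = {𝔮 | P ≤ 𝔮.asIdeal})
    {n : ℕ} (u : Fin n → S) (w : Fin n → ℕ)
    (hspan : Ideal.span (Set.range u) = maximalIdeal S) (hrk : (maximalIdeal S).spanFinrank = n)
    (hctr : Ideal.span {x | ∃ i, 0 < w i ∧ x = u i} = P)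
    (hpres : ∀ m : ℕ, weightedMonomialIdeal u w m = jFlatT S f m)
    (hb : ∀ (𝔫 : Ideal (cobordantAlgebra' u w)) [𝔫.IsPrime], IsTHomogeneous u w 𝔫 → cobordantT' u w ∈ 𝔫 →
      (maximalIdeal S).map (algebraMap S (cobordantAlgebra' u w)) ≤ 𝔫 →
      ¬ extReesAlgebra.vertexIdeal (weightedMonomialIdeal u w) ≤ 𝔫 →
      ∀ (a : ℕ) (g : cobordantAlgebra' u w), algebraMap S (cobordantAlgebra' u w) f = cobordantT' u w ^ a * g →
        ¬ cobordantT' u w ∣ g →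
        algebraMap (cobordantAlgebra' u w) (Localization.AtPrime 𝔫) g ∈ maximalIdeal (Localization.AtPrime 𝔫) ^ 2 →
        iotaFlatT (Localization.AtPrime 𝔫) (algebraMap (cobordantAlgebra' u w) (Localization.AtPrime 𝔫) g) < iotaFlatT S f) :
    WeightedDropHom iotaFlatT S f P u w := by
  intro 𝔫 _ hhom hT hP𝔫 hV a g hfg hTg hg2
  haveI hQ : (𝔫.comap (algebraMap S (cobordantAlgebra' u w))).IsPrime := Ideal.IsPrime.comap _
  have hPQ : P ≤ 𝔫.comap (algebraMap S (cobordantAlgebra' u w)) := fun x hx =>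
    Ideal.mem_comap.mpr (hP𝔫 (Ideal.mem_map_of_mem _ hx))
  by_cases hQm : 𝔫.comap (algebraMap S (cobordantAlgebra' u w)) = maximalIdeal S
  · exact hb 𝔫 hhom hT (by rw [← hQm]; exact Ideal.map_comap_le) hV a g hfg hTg hg2
  · have hQlt : 𝔫.comap (algebraMap S (cobordantAlgebra' u w)) < maximalIdeal S :=
      lt_of_le_of_ne (IsLocalRing.le_maximalIdeal hQ.ne_top) hQm
    have hQ2 : (𝔫.comap (algebraMap S (cobordantAlgebra' u w))).height ≤ ((2 : ℕ) : ℕ∞) :=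
      height_le_of_lt_of_height_le hQlt (height_maximalIdeal_le_of_ringKrullDim_le_three hd)
    by_cases hQP : 𝔫.comap (algebraMap S (cobordantAlgebra' u w)) = P
    · -- TYPE (a): the successor lies over the generic point of the centre
      have hP2 : P.height ≤ ((2 : ℕ) : ℕ∞) := hQP ▸ hQ2
      have hdimP : ringKrullDim (Localization.AtPrime P) ≤ 2 := by
        exact_mod_cast ringKrullDim_localization_le_of_height_le P hP2
      exact iotaFlatT_successor_lt_of_over_generic_point p k₀ S hf0 hf2 P hE hdimP u w hpres 𝔫 hT hP𝔫 hV hQP.le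
        a g hfg hTg hg2
    · -- `P < Q < 𝔪`: the centre is a divisor; no singular successor
      have hPlt : P < 𝔫.comap (algebraMap S (cobordantAlgebra' u w)) := lt_of_le_of_ne hPQ (Ne.symm hQP)
      have hP1 : P.height ≤ ((1 : ℕ) : ℕ∞) :=
        height_le_of_lt_of_height_le hPlt (by
          have h11 : ((1 : ℕ) : ℕ∞) + 1 = ((2 : ℕ) : ℕ∞) := by norm_num
          rw [h11]
          exact hQ2)
      have hdimP : ringKrullDim (Localization.AtPrime P) ≤ 1 := by
        exact_mod_cast ringKrullDim_localization_le_of_height_le P hP1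
      exact DivCentre.weightedDrop_of_dim_le_one S hf0 P hfP hE hdimP u w hspan hrk hctr hpres iotaFlatT 𝔫 hT hP𝔫 hV
        a g hfg hTg hg2

/-! ## §3 hgame ⟸ (D-b); the gap lists of record -/

/-- **hgame ⟸ (D-b).**  `CanonicalGameClauseHomLE 3 p iotaFlatT jFlatT` follows from the `ι₃ᵗ`-drop at the `t`-homogeneous successors over
the closed point, for every weighted rsp presentation of the canonical centre of a door position. [OURS · L1 W4.3 · audit glue] -/
theorem canonicalGameClauseHomLE_three_of_dropb (p : ℕ)
    (hDROPb : ∀ (k₀ : Type) [Field k₀] [CharP k₀ p] [PerfectField k₀]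
      (S : Type) [CommRing S] [Algebra k₀ S] [Algebra.EssFiniteType k₀ S] [IsRegularLocalRing S]
      (f : S), ringKrullDim S ≤ 3 → f ≠ 0 → f ∈ (maximalIdeal S) ^ 2 →
      ∀ (P : Ideal S) [P.IsPrime], IsRegularLocalRing (S ⧸ P) → f ∈ P →
        topStratum iotaOrdEpsTau S f = {𝔮 | P ≤ 𝔮.asIdeal} →
        ∀ (n : ℕ) (u : Fin n → S) (w : Fin n → ℕ),
          Ideal.span (Set.range u) = maximalIdeal S → (maximalIdeal S).spanFinrank = n → (∃ i, 0 < w i) →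
          Ideal.span {x | ∃ i, 0 < w i ∧ x = u i} = P →
          (∀ m : ℕ, weightedMonomialIdeal u w m = jFlatT S f m) →
          ∀ (𝔫 : Ideal (cobordantAlgebra' u w)) [𝔫.IsPrime], IsTHomogeneous u w 𝔫 → cobordantT' u w ∈ 𝔫 →
            (maximalIdeal S).map (algebraMap S (cobordantAlgebra' u w)) ≤ 𝔫 →
            ¬ extReesAlgebra.vertexIdeal (weightedMonomialIdeal u w) ≤ 𝔫 →
            ∀ (a : ℕ) (g : cobordantAlgebra' u w), algebraMap S (cobordantAlgebra' u w) f = cobordantT' u w ^ a * g →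
              ¬ cobordantT' u w ∣ g →
              algebraMap (cobordantAlgebra' u w) (Localization.AtPrime 𝔫) g ∈ maximalIdeal (Localization.AtPrime 𝔫) ^ 2 →
              iotaFlatT (Localization.AtPrime 𝔫) (algebraMap (cobordantAlgebra' u w) (Localization.AtPrime 𝔫) g) <
                iotaFlatT S f) :
    CanonicalGameClauseHomLE 3 p iotaFlatT jFlatT :=
  canonicalGameClauseHomLE_three_of_drop p fun k₀ _ _ _ S _ _ _ _ f hd hf0 hf2 P _ hreg hfP hE n u w h1 h2 h3 h4 h5 =>
    weightedDropHom_of_drop_over_closedPoint_door p k₀ S hd hf0 hf2 P hfP hE u w h1 h2 h4 h5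
      (hDROPb k₀ S f hd hf0 hf2 P hreg hfP hE n u w h1 h2 h3 h4 h5)

end Iota3

open Iota3

/-- **GAP LIST OF RECORD for `stub_keyRungGrHomLE_three` — hD + (D-b).**  `KeyRungGrHomLE 3 p` from hD ((desc-τ) AS TYPED over all regular
local rings; door-proved `Iota3.isTiePosition_descent_door`; TYPING ITEM) and (D-b): the `ι₃ᵗ`-drop at the `t`-homogeneous successor primes
OVER THE CLOSED POINT of the weighted blow-up of the canonical centre, for every door position and every weighted rsp presentation of
`(P, J₃ᵗ)` — the characteristic-`p` point drop, the substance of the crux.  ((PRES)₃, TYPE (a), (D-div) are discharged.)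
[OURS · L1 W4.3 · audit glue] -/
theorem keyRungGrHomLE_three_of_tieDescent_dropb (p : ℕ)
    (hD : ∀ (T T' : Type) [CommRing T] [IsRegularLocalRing T] [CommRing T'] [IsRegularLocalRing T'] [Algebra T T']
      [IsLocalHom (algebraMap T T')] [Algebra.FormallySmooth T T'] [Algebra.EssFiniteType T T'] (g : T),
      ringKrullDim T' ≤ 3 → IsTiePosition T' (algebraMap T T' g) → IsTiePosition T g)
    (hDROPb : ∀ (k₀ : Type) [Field k₀] [CharP k₀ p] [PerfectField k₀]
      (S : Type) [CommRing S] [Algebra k₀ S] [Algebra.EssFiniteType k₀ S] [IsRegularLocalRing S]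
      (f : S), ringKrullDim S ≤ 3 → f ≠ 0 → f ∈ (maximalIdeal S) ^ 2 →
      ∀ (P : Ideal S) [P.IsPrime], IsRegularLocalRing (S ⧸ P) → f ∈ P →
        topStratum iotaOrdEpsTau S f = {𝔮 | P ≤ 𝔮.asIdeal} →
        ∀ (n : ℕ) (u : Fin n → S) (w : Fin n → ℕ),
          Ideal.span (Set.range u) = maximalIdeal S → (maximalIdeal S).spanFinrank = n → (∃ i, 0 < w i) →
          Ideal.span {x | ∃ i, 0 < w i ∧ x = u i} = P →
          (∀ m : ℕ, weightedMonomialIdeal u w m = jFlatT S f m) →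
          ∀ (𝔫 : Ideal (cobordantAlgebra' u w)) [𝔫.IsPrime], IsTHomogeneous u w 𝔫 → cobordantT' u w ∈ 𝔫 →
            (maximalIdeal S).map (algebraMap S (cobordantAlgebra' u w)) ≤ 𝔫 →
            ¬ extReesAlgebra.vertexIdeal (weightedMonomialIdeal u w) ≤ 𝔫 →
            ∀ (a : ℕ) (g : cobordantAlgebra' u w), algebraMap S (cobordantAlgebra' u w) f = cobordantT' u w ^ a * g →
              ¬ cobordantT' u w ∣ g →
              algebraMap (cobordantAlgebra' u w) (Localization.AtPrime 𝔫) g ∈ maximalIdeal (Localization.AtPrime 𝔫) ^ 2 →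
              iotaFlatT (Localization.AtPrime 𝔫) (algebraMap (cobordantAlgebra' u w) (Localization.AtPrime 𝔫) g) <
                iotaFlatT S f) :
    KeyRungGrHomLE 3 p :=
  keyRungGrHomLE_three_of_game p hD (canonicalGameClauseHomLE_three_of_dropb p hDROPb)

/-- **GAP LIST OF RECORD, (c11)-form — (c11)≤3 + (D-b)**: `KeyRungGrHomLE 3 p` from the rung clause (c11)≤3
`IotaJEssSmoothCompatibleLE 3 iotaFlatT jFlatT` AS TYPED (typing item) and (D-b). [OURS · L1 W4.3 · audit glue] -/
theorem keyRungGrHomLE_three_of_c11_dropb (p : ℕ) (hc11 : IotaJEssSmoothCompatibleLE 3 iotaFlatT jFlatT)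
    (hDROPb : ∀ (k₀ : Type) [Field k₀] [CharP k₀ p] [PerfectField k₀]
      (S : Type) [CommRing S] [Algebra k₀ S] [Algebra.EssFiniteType k₀ S] [IsRegularLocalRing S]
      (f : S), ringKrullDim S ≤ 3 → f ≠ 0 → f ∈ (maximalIdeal S) ^ 2 →
      ∀ (P : Ideal S) [P.IsPrime], IsRegularLocalRing (S ⧸ P) → f ∈ P →
        topStratum iotaOrdEpsTau S f = {𝔮 | P ≤ 𝔮.asIdeal} →
        ∀ (n : ℕ) (u : Fin n → S) (w : Fin n → ℕ),
          Ideal.span (Set.range u) = maximalIdeal S → (maximalIdeal S).spanFinrank = n → (∃ i, 0 < w i) →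
          Ideal.span {x | ∃ i, 0 < w i ∧ x = u i} = P →
          (∀ m : ℕ, weightedMonomialIdeal u w m = jFlatT S f m) →
          ∀ (𝔫 : Ideal (cobordantAlgebra' u w)) [𝔫.IsPrime], IsTHomogeneous u w 𝔫 → cobordantT' u w ∈ 𝔫 →
            (maximalIdeal S).map (algebraMap S (cobordantAlgebra' u w)) ≤ 𝔫 →
            ¬ extReesAlgebra.vertexIdeal (weightedMonomialIdeal u w) ≤ 𝔫 →
            ∀ (a : ℕ) (g : cobordantAlgebra' u w), algebraMap S (cobordantAlgebra' u w) f = cobordantT' u w ^ a * g →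
              ¬ cobordantT' u w ∣ g →
              algebraMap (cobordantAlgebra' u w) (Localization.AtPrime 𝔫) g ∈ maximalIdeal (Localization.AtPrime 𝔫) ^ 2 →
              iotaFlatT (Localization.AtPrime 𝔫) (algebraMap (cobordantAlgebra' u w) (Localization.AtPrime 𝔫) g) <
                iotaFlatT S f) :
    KeyRungGrHomLE 3 p :=
  keyRungGrHomLE_three_of_c11_game p hc11 (canonicalGameClauseHomLE_three_of_dropb p hDROPb)

/-- **GAP LIST OF RECORD (named-pair form) — hD + (D-b)**: `PRungGrHomLE 3 p iotaFlatT jFlatT`. [OURS · L1 W4.3 · audit glue] -/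
theorem pRungGrHomLE_three_of_tieDescent_dropb (p : ℕ)
    (hD : ∀ (T T' : Type) [CommRing T] [IsRegularLocalRing T] [CommRing T'] [IsRegularLocalRing T'] [Algebra T T']
      [IsLocalHom (algebraMap T T')] [Algebra.FormallySmooth T T'] [Algebra.EssFiniteType T T'] (g : T),
      ringKrullDim T' ≤ 3 → IsTiePosition T' (algebraMap T T' g) → IsTiePosition T g)
    (hDROPb : ∀ (k₀ : Type) [Field k₀] [CharP k₀ p] [PerfectField k₀]
      (S : Type) [CommRing S] [Algebra k₀ S] [Algebra.EssFiniteType k₀ S] [IsRegularLocalRing S]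
      (f : S), ringKrullDim S ≤ 3 → f ≠ 0 → f ∈ (maximalIdeal S) ^ 2 →
      ∀ (P : Ideal S) [P.IsPrime], IsRegularLocalRing (S ⧸ P) → f ∈ P →
        topStratum iotaOrdEpsTau S f = {𝔮 | P ≤ 𝔮.asIdeal} →
        ∀ (n : ℕ) (u : Fin n → S) (w : Fin n → ℕ),
          Ideal.span (Set.range u) = maximalIdeal S → (maximalIdeal S).spanFinrank = n → (∃ i, 0 < w i) →
          Ideal.span {x | ∃ i, 0 < w i ∧ x = u i} = P →
          (∀ m : ℕ, weightedMonomialIdeal u w m = jFlatT S f m) →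
          ∀ (𝔫 : Ideal (cobordantAlgebra' u w)) [𝔫.IsPrime], IsTHomogeneous u w 𝔫 → cobordantT' u w ∈ 𝔫 →
            (maximalIdeal S).map (algebraMap S (cobordantAlgebra' u w)) ≤ 𝔫 →
            ¬ extReesAlgebra.vertexIdeal (weightedMonomialIdeal u w) ≤ 𝔫 →
            ∀ (a : ℕ) (g : cobordantAlgebra' u w), algebraMap S (cobordantAlgebra' u w) f = cobordantT' u w ^ a * g →
              ¬ cobordantT' u w ∣ g →
              algebraMap (cobordantAlgebra' u w) (Localization.AtPrime 𝔫) g ∈ maximalIdeal (Localization.AtPrime 𝔫) ^ 2 →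
              iotaFlatT (Localization.AtPrime 𝔫) (algebraMap (cobordantAlgebra' u w) (Localization.AtPrime 𝔫) g) <
                iotaFlatT S f) :
    PRungGrHomLE 3 p iotaFlatT jFlatT :=
  pRungGrHomLE_three_of_tieDescent_game p hD (canonicalGameClauseHomLE_three_of_dropb p hDROPb)

end Summit.ResolutionOfSingularities.ResolutionOfSingularities.Cruxes.HypersurfaceCentreConstruction.LocalEngine

end
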